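import Summits.RiemannHypothesis.RiemannHypothesis.Theorems.PfPersistenceCoupledPresentation
import Summits.RiemannHypothesis.RiemannHypothesis.Theorems.PfPersistenceScaleInvariance
import HarnessLib

/-!
# PF persistence — coupled readers II: STRIP-SEEDED strength schema, SCALE-FREENESS of the twins, and the
# TWO-PARITY (sector) coupled presentation (pub-rhpf barrier-typer gen 8; follow-ups (4) of the gen-7 handoff)

**HONEST FRAMING. Long-odds MECHANISM SEARCH; no RH claims.** Labels PROVED / TYPED / DATA as in
`PfPersistenceAdmissibleClass.lean`; RH-free bookkeeping about the SHAPE of criteria, except §1's CONDITIONAL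
"member of the class + a positive seed strip ⇒ RH" (RH-strength label E1, credits nothing — nobody has either
hypothesis beyond the proved strip `(0, log 3 / 2)`). CONTEXT: `PfPersistenceCoupledPresentation` (951862827d34)
typed the `k`-window COUPLED open presentation `IsCoupledOpen k h hh` (clause (1′) of G1), proved clause (3) is
automatic for it, placed the STRICT STRIDE TWIN `strideTwinStrict h hh c Φ` in `G1-coupled(2, h)` and in none of
G1-cont/contU/int, and gave its strength ONLY for strides `h < log 3 / 2` (seed = the proved rung near `a = 0`).
This file (new decls only; nothing landed is edited):
§1 STRIP SEED (any datum, any height): `d ∈ strideTwinStrict h hh c Φ` and `0 < ε₁(d win)` on ONE strip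
`aₛ ≤ a ≤ aₛ + h` (`0 ≤ aₛ`) ⇒ `0 < ε₁(d win)` at EVERY window of height `≥ aₛ`
(`bottomRayleigh_pos_of_mem_strideTwinStrict_of_stripSeed`, induction on strides); for `d = ζ` this gives RH
from a Galerkin strip seed (`riemannHypothesis_of_zeta_mem_strideTwinStrict_of_stripSeed`) or from a CONTINUUM
even-sector strip seed `0 < ε_ev(a)` on `[aₛ, aₛ + h]` (`…_of_evenSeed`, via Rayleigh–Ritz
`weilEvenGroundEnergy_le_bottomRayleigh'`); the `h < log 3 / 2` theorem of 951862827d34 is the instance `aₛ = 0`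
(re-derived as an `example`). READING for rows: an exact-stride strict law is RH-strength member-wise as soon as ANY
strip of width `≥ h` is certified positive uniformly in `N` — the seed need not sit near `a = 0`.
§2 SCALE-FREENESS (A115 (5) vocabulary, `ScaleInvariant` 5e206f769774): the strict stride twin and cand-3's all-pairs
`transportTwin` (94721571e2b4) are SCALE-INVARIANT (`ε₁(s•M) = s·ε₁(M)`, both sides of a multiplicative law scale
alike) — theorems ABOUT those defs, no def edited; the twins read no raw level.
§3 TWO-PARITY COUPLED PRESENTATION (R23 companion): a joint reader of the (even block, read-off odd block) pairs at
`k` look-ahead windows with OPEN verdict sets presents a COUPLED-OPEN class of the even data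
(`isCoupledOpen_parityCoupledClass`), because the parity dictionary `oddOfEven` is continuous
(`continuous_oddOfEven`); conversely every coupled-open class is parity-presented (`isCoupledOpen_iff_parity`) — the
sector presentation is NOT a new stratum. Hence sector coupled readers inherit VERBATIM: clause (3) automatic
(`IsCoupledOpen.dialStable`), the certificate schema (`inG1coupled_parityCoupledClass`), and W1 on bounded anchor sets
(`not_separates_parityCoupledClassOn_below`, every `D ⊇ arithDialSpace`).
NOT SAID: any membership of `ζ` in any twin (DATA / E1); any seed strip beyond `(0, log 3 / 2)` (DATA only);
anything about `transportTwin`'s dial-stability (cand-3's MONO-F words stand); W2 untouched.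
-/

set_option linter.dupNamespace false  -- the mandated namespace repeats `RiemannHypothesis`

noncomputable section

open Real Set Matrix Filter Topology
open Literature.NumberTheory.LFunctions
open Summit.RiemannHypothesis.RiemannHypothesis.Theorems.SpectralTraceWindowStep

namespace Summit.RiemannHypothesis.RiemannHypothesis.Theorems.PfPersistence

/-! ## §1 Strip-seeded strength schema for the exact-stride strict law -/

/-- **PROVED — STRIP SEED TRANSPORT (any datum):** if `d ∈ strideTwinStrict h hh c Φ` (`0 < h`, `0 < c`, `Φ > 0`)
and `0 < ε₁(d win)` on the strip `aₛ ≤ a ≤ aₛ + h` (`0 ≤ aₛ`, every `N`), then `0 < ε₁(d win)` at EVERY window of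
height `≥ aₛ` (induction on the number of strides above the strip). [folklore] -/
theorem bottomRayleigh_pos_of_mem_strideTwinStrict_of_stripSeed {h : ℝ} {hh : 0 ≤ h} (hpos : 0 < h) {c : ℝ}
    (hc : 0 < c) {Φ : ℝ → ℝ} (hΦpos : ∀ a, 0 < Φ a) {d : Datum} (hd : d ∈ strideTwinStrict h hh c Φ) {aₛ : ℝ}
    (haₛ : 0 ≤ aₛ) (hseed : ∀ win : Window, aₛ ≤ win.a → win.a ≤ aₛ + h → 0 < bottomRayleigh (d win))
    (win : Window) (hwin : aₛ ≤ win.a) : 0 < bottomRayleigh (d win) := by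
  have hlaw := mem_strideTwinStrict.1 hd
  -- induction on the number of strides: positivity on `aₛ ≤ a ≤ aₛ + h + n·h`
  have step : ∀ n : ℕ, ∀ w : Window, aₛ ≤ w.a → w.a ≤ aₛ + h + n * h → 0 < bottomRayleigh (d w) := by
    intro n
    induction n with
    | zero => intro w h1 h2; exact hseed w h1 (by simp only [Nat.cast_zero, zero_mul, add_zero] at h2; exact h2)
    | succ n ih =>
      intro w h1 h2
      by_cases hle : w.a ≤ aₛ + h + n * h
      · exact ih w h1 hle
      · have hgt := not_le.1 hle
        have hlow : 0 < w.a - h := by nlinarith [n.cast_nonneg (α := ℝ)]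
        let w' : Window := ⟨w.a - h, w.N, hlow⟩
        have e : w'.lookAhead h hh 1 = w := by
          obtain ⟨a, N, ha⟩ := w; simp [w', Window.lookAhead, Window.stepUp]
        have h01 := hlaw w'
        rw [e] at h01
        have h0 : 0 < bottomRayleigh (d (w'.lookAhead h hh 0)) := ih _
          (by show aₛ ≤ w.a - h + (0 : ℕ) * h; push_cast; nlinarith [n.cast_nonneg (α := ℝ)])
          (by show w.a - h + (0 : ℕ) * h ≤ aₛ + h + n * h; push_cast at h2 ⊢; linarith)
        exact (mul_pos_iff_of_pos_left (hΦpos _)).1 ((mul_pos hc (mul_pos (hΦpos _) h0)).trans h01)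
  refine step ⌈(win.a - aₛ) / h⌉₊ win hwin ?_
  have h1 : (win.a - aₛ) / h ≤ ⌈(win.a - aₛ) / h⌉₊ := Nat.le_ceil _
  have h2 : win.a - aₛ = (win.a - aₛ) / h * h := by field_simp
  nlinarith

/-- **PROVED (CONDITIONAL, E1; no RH claim) — STRIP-SEEDED STRENGTH of the exact-stride law:** `ζ ∈
strideTwinStrict h hh c Φ` plus a positive GALERKIN strip `0 < ε₁(ζ(a, N))` for `aₛ ≤ a ≤ aₛ + h`, all `N`
(`0 ≤ aₛ`) ⇒ RH. Nobody has either hypothesis beyond the proved strip near `0`. [folklore] -/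
theorem riemannHypothesis_of_zeta_mem_strideTwinStrict_of_stripSeed {h : ℝ} {hh : 0 ≤ h} (hpos : 0 < h) {c : ℝ}
    (hc : 0 < c) {Φ : ℝ → ℝ} (hΦpos : ∀ a, 0 < Φ a) {aₛ : ℝ} (haₛ : 0 ≤ aₛ)
    (hseed : ∀ win : Window, aₛ ≤ win.a → win.a ≤ aₛ + h → 0 < bottomRayleigh (zetaDatum win))
    (hζ : zetaDatum ∈ strideTwinStrict h hh c Φ) : RiemannHypothesis :=
  riemannHypothesis_of_eventually_nonneg (A := aₛ) fun win hwin =>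
    (bottomRayleigh_pos_of_mem_strideTwinStrict_of_stripSeed hpos hc hΦpos hζ haₛ hseed win hwin.le).le

/-- **PROVED (CONDITIONAL, E1; no RH claim) — CONTINUUM strip seed:** `ζ ∈ strideTwinStrict h hh c Φ` plus
`0 < ε_ev(a)` (continuum even-sector ground energy) on `[aₛ, aₛ + h]` ⇒ RH; the Galerkin seed follows from
Rayleigh–Ritz `ε_ev(a) ≤ ε₁(ζ(a, N))` (`weilEvenGroundEnergy_le_bottomRayleigh'`), uniformly in `N`. [folklore] -/
theorem riemannHypothesis_of_zeta_mem_strideTwinStrict_of_evenSeed {h : ℝ} {hh : 0 ≤ h} (hpos : 0 < h) {c : ℝ}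
    (hc : 0 < c) {Φ : ℝ → ℝ} (hΦpos : ∀ a, 0 < Φ a) {aₛ : ℝ} (haₛ : 0 ≤ aₛ)
    (hseed : ∀ a : ℝ, aₛ ≤ a → a ≤ aₛ + h → 0 < weilEvenGroundEnergy a)
    (hζ : zetaDatum ∈ strideTwinStrict h hh c Φ) : RiemannHypothesis :=
  riemannHypothesis_of_zeta_mem_strideTwinStrict_of_stripSeed hpos hc hΦpos haₛ
    (fun win h1 h2 => (hseed win.a h1 h2).trans_le (weilEvenGroundEnergy_le_bottomRayleigh' win)) hζ

/-- PROVED (consistency): the `h < log 3 / 2` theorem of 951862827d34 is the instance `aₛ = 0` of the strip schema,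
seeded by the proved rung `weilGroundEnergy_pos_of_lt_log_three_half'`. [folklore] -/
example {h : ℝ} {hh : 0 ≤ h} (hpos : 0 < h) (hlog : h < Real.log 3 / 2) {c : ℝ} (hc : 0 < c) {Φ : ℝ → ℝ}
    (hΦpos : ∀ a, 0 < Φ a) (hζ : zetaDatum ∈ strideTwinStrict h hh c Φ) (win : Window) :
    0 < bottomRayleigh (zetaDatum win) :=
  bottomRayleigh_pos_of_mem_strideTwinStrict_of_stripSeed hpos hc hΦpos hζ le_rfl
    (fun w _ hw => ((weilGroundEnergy_pos_of_lt_log_three_half' w.ha (by linarith)).trans_le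
      (weilGroundEnergy_le_weilEvenGroundEnergy _)).trans_le (weilEvenGroundEnergy_le_bottomRayleigh' w))
    win win.ha.le

/-! ## §2 Scale-freeness of the twins (theorems about existing defs; no def edited) -/

/-- **PROVED — the strict stride twin is SCALE-INVARIANT** (`ε₁(s•M) = s·ε₁(M)`, `s > 0`). [folklore] -/
theorem scaleInvariant_strideTwinStrict (h : ℝ) (hh : 0 ≤ h) (c : ℝ) (Φ : ℝ → ℝ) :
    ScaleInvariant (strideTwinStrict h hh c Φ) := by
  intro s hs d
  simp only [mem_strideTwinStrict, smul_datum_apply, bottomRayleigh_smul hs]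
  refine forall_congr' fun win => ?_
  rw [show c * (Φ win.a * (s * bottomRayleigh (d (win.lookAhead h hh 0)))) =
      s * (c * (Φ win.a * bottomRayleigh (d (win.lookAhead h hh 0)))) by ring,
    show Φ (win.a + h) * (s * bottomRayleigh (d (win.lookAhead h hh 1))) =
      s * (Φ (win.a + h) * bottomRayleigh (d (win.lookAhead h hh 1))) by ring]
  exact mul_lt_mul_iff_right₀ hs

/-- **PROVED — cand-3's all-pairs transport twin `transportTwin a₀ h c Φ T` (94721571e2b4) is SCALE-INVARIANT**
(a theorem about that def; its dial-stability words are untouched). [folklore] -/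
theorem scaleInvariant_transportTwin (a₀ h c : ℝ) (Φ : ℝ → ℝ) (T : Set Window) :
    ScaleInvariant (transportTwin a₀ h c Φ T) := by
  intro s hs d
  simp only [transportTwin, mem_setOf_eq, smul_datum_apply, bottomRayleigh_smul hs]
  refine forall₅_congr fun N a a' ha ha' => forall₅_congr fun _ _ _ _ _ => ?_
  rw [show c * (Φ a * (s * bottomRayleigh (d ⟨a, N, ha⟩))) = s * (c * (Φ a * bottomRayleigh (d ⟨a, N, ha⟩)))
      by ring,
    show Φ a' * (s * bottomRayleigh (d ⟨a', N, ha'⟩)) = s * (Φ a' * bottomRayleigh (d ⟨a', N, ha'⟩)) by ring]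
  exact mul_le_mul_iff_right₀ hs

/-! ## §3 The two-parity (sector) coupled presentation is the coupled presentation -/

/-- PROVED: the parity dictionary `oddOfEven` (even block ↦ read-off odd block) is CONTINUOUS. [folklore] -/
theorem continuous_oddOfEven (N : ℕ) :
    Continuous (oddOfEven : Matrix (Fin (N + 1)) (Fin (N + 1)) ℝ → Matrix (Fin N) (Fin N) ℝ) := by
  refine continuous_matrix fun i j => ?_
  simp only [oddOfEven, deflatedBody]
  exact continuous_const.mul
    ((continuous_id.matrix_elem _ _).sub (continuous_const.mul (continuous_id.matrix_elem _ _)))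

/-- PROVED: `ε₁` is continuous on `n × n` matrices for EVERY `n` (the `0 × 0` case is a constant). [folklore] -/
theorem continuous_bottomRayleigh' (n : ℕ) : Continuous (bottomRayleigh : Matrix (Fin n) (Fin n) ℝ → ℝ) := by
  cases n with
  | zero => exact continuous_of_const fun M M' => by rw [Subsingleton.elim M M']
  | succ n => exact continuous_bottomRayleigh n

/-- a `k`-WINDOW TWO-PARITY JOINT READER: at each anchor, a set of `k`-tuples of (even block, odd block) pairs at the
look-ahead windows (sector readers: order bits, parity indices, odd signs, jointly over `k` windows). [folklore] -/
abbrev ParityCoupledReader (k : ℕ) (h : ℝ) (hh : 0 ≤ h) : Type :=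
  (win : Window) →
    Set ((j : Fin k) → Matrix (Fin ((win.lookAhead h hh j).N + 1)) (Fin ((win.lookAhead h hh j).N + 1)) ℝ ×
      Matrix (Fin (win.lookAhead h hh j).N) (Fin (win.lookAhead h hh j).N) ℝ)

/-- the TWO-PARITY TUPLE of `d` at the `k` look-ahead windows: (even block, read-off odd block `oddDatum`). [folklore] -/
def parityTupleAt (k : ℕ) (h : ℝ) (hh : 0 ≤ h) (d : Datum) (win : Window) :
    (j : Fin k) → Matrix (Fin ((win.lookAhead h hh j).N + 1)) (Fin ((win.lookAhead h hh j).N + 1)) ℝ ×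
      Matrix (Fin (win.lookAhead h hh j).N) (Fin (win.lookAhead h hh j).N) ℝ :=
  fun j => (d (win.lookAhead h hh j), oddDatum d (win.lookAhead h hh j))

/-- the TWO-PARITY COUPLED CLASS of a joint sector reader (verdict at every anchor). [folklore] -/
def parityCoupledClass (k : ℕ) (h : ℝ) (hh : 0 ≤ h) (Q : ParityCoupledReader k h hh) : Set Datum :=
  {d | ∀ win, parityTupleAt k h hh d win ∈ Q win}

/-- the two-parity coupled class with anchors restricted to `T` (served grids). [folklore] -/
def parityCoupledClassOn (T : Set Window) (k : ℕ) (h : ℝ) (hh : 0 ≤ h) (Q : ParityCoupledReader k h hh) :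
    Set Datum :=
  {d | ∀ win ∈ T, parityTupleAt k h hh d win ∈ Q win}

/-- the even-block joint reader PRESENTING a sector reader: pull `Q` back along `m ↦ (m_j, oddOfEven m_j)_j`. [folklore] -/
def CoupledReader.ofParity {k : ℕ} {h : ℝ} {hh : 0 ≤ h} (Q : ParityCoupledReader k h hh) : CoupledReader k h hh :=
  fun win => {m | (fun j => (m j, oddOfEven (m j))) ∈ Q win}

/-- PROVED: the pulled-back verdict set is OPEN when the sector verdict set is (continuity of `oddOfEven`). [folklore] -/
theorem CoupledReader.isOpen_ofParity {k : ℕ} {h : ℝ} {hh : 0 ≤ h} {Q : ParityCoupledReader k h hh} {win : Window}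
    (hQ : IsOpen (Q win)) : IsOpen (CoupledReader.ofParity Q win) :=
  hQ.preimage (continuous_pi fun j =>
    (continuous_apply j).prodMk ((continuous_oddOfEven _).comp (continuous_apply j)))

/-- PROVED (definitional): the pulled-back coupled class IS the two-parity class. [folklore] -/
theorem coupledClass_ofParity {k : ℕ} {h : ℝ} {hh : 0 ≤ h} (Q : ParityCoupledReader k h hh) :
    coupledClass k h hh (CoupledReader.ofParity Q) = parityCoupledClass k h hh Q := rfl

/-- PROVED (definitional): likewise with restricted anchors. [folklore] -/
theorem coupledClassOn_ofParity (T : Set Window) {k : ℕ} {h : ℝ} {hh : 0 ≤ h} (Q : ParityCoupledReader k h hh) :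
    coupledClassOn T k h hh (CoupledReader.ofParity Q) = parityCoupledClassOn T k h hh Q := rfl

/-- **PROVED — A SECTOR (two-parity) joint reader with OPEN verdict sets presents a COUPLED-OPEN class:** clause
(1′) holds for it exactly as for even-block joint readers. [folklore] -/
theorem isCoupledOpen_parityCoupledClass {k : ℕ} {h : ℝ} {hh : 0 ≤ h} {Q : ParityCoupledReader k h hh}
    (hQ : ∀ win, IsOpen (Q win)) : IsCoupledOpen k h hh (parityCoupledClass k h hh Q) :=
  ⟨CoupledReader.ofParity Q, fun _ => CoupledReader.isOpen_ofParity (hQ _), (coupledClass_ofParity Q).symm⟩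

/-- **PROVED — conversely every coupled-open class is parity-presented with open verdict sets** (forget the odd
coordinate): the two-parity presentation is NOT a new stratum. [folklore] -/
theorem isCoupledOpen_iff_parity {k : ℕ} {h : ℝ} {hh : 0 ≤ h} {S : Set Datum} :
    IsCoupledOpen k h hh S ↔
      ∃ Q : ParityCoupledReader k h hh, (∀ win, IsOpen (Q win)) ∧ S = parityCoupledClass k h hh Q := by
  constructor
  · rintro ⟨P, hP, rfl⟩
    refine ⟨fun win => {t | (fun j => (t j).1) ∈ P win}, fun win =>
      (hP win).preimage (continuous_pi fun j => continuous_fst.comp (continuous_apply j)), ?_⟩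
    rfl
  · rintro ⟨Q, hQ, rfl⟩
    exact isCoupledOpen_parityCoupledClass hQ

/-- **PROVED — CERTIFICATE SCHEMA for sector coupled readers:** open verdict sets + height exits ⇒
`G1-coupled(k, h)` (clause (3) automatic, `IsCoupledOpen.dialStable`). [folklore] -/
theorem inG1coupled_parityCoupledClass {k : ℕ} {h : ℝ} {hh : 0 ≤ h} {Q : ParityCoupledReader k h hh}
    (hQ : ∀ win, IsOpen (Q win)) (hnl : NonlocalAtEveryHeight (parityCoupledClass k h hh Q)) :
    InG1coupled k h hh (parityCoupledClass k h hh Q) :=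
  inG1coupled_of (isCoupledOpen_parityCoupledClass hQ) hnl

/-- **PROVED — W1 for every SECTOR coupled reader on a BOUNDED anchor set** (every `D ⊇ arithDialSpace`): anchors
below `A` ⇒ decided below `A + k·h` ⇒ no separation (`not_separates_coupledClassOn_below`). [folklore] -/
theorem not_separates_parityCoupledClassOn_below {D : Set Datum} (hD : arithDialSpace ⊆ D) {A : ℝ}
    {T : Set Window} (hT : T ⊆ below A) (k : ℕ) (h : ℝ) (hh : 0 ≤ h) (Q : ParityCoupledReader k h hh) :
    ¬ Separates (parityCoupledClassOn T k h hh Q) D zetaDatum := by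
  rw [← coupledClassOn_ofParity]
  exact not_separates_coupledClassOn_below hD hT k h hh _

/-- PROVED: a sector coupled class anchored below `A` is DECIDED below `A + k·h` (the finite-window content). [folklore] -/
theorem determinedOn_parityCoupledClassOn_below {A : ℝ} {T : Set Window} (hT : T ⊆ below A) (k : ℕ) (h : ℝ)
    (hh : 0 ≤ h) (Q : ParityCoupledReader k h hh) :
    DeterminedOn (parityCoupledClassOn T k h hh Q) (below (A + k * h)) := by
  rw [← coupledClassOn_ofParity]
  exact determinedOn_coupledClassOn_below hT k h hh _

end Summit.RiemannHypothesis.RiemannHypothesis.Theorems.PfPersistence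

end
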